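import Mathlib.Topology.Connected.Clopen
import Literature.Geometry.Kaehler.ManifoldFormsChart
import Literature.Geometry.Symplectic.GirouxContactPathAlgebra
import HarnessLib

/-!
# Sign propagation of `α ∧ dα` for two contact-type `1`-forms on a connected `3`-manifold

Topic `Literature/Geometry/Symplectic`; namespace `Literature.Geometry.Symplectic`.  A proofs-only
file (no definition, no named fact): the folklore statement that the sign of `α ∧ dα` is a property
of the orientation alone, in the form used to compare two co-oriented contact structures supported
by ONE open book on the seam of a Stein gluing (consumer: the Literature-side reduction of the named
fact `Literature.Geometry.Symplectic.steinRealisation_of_sorted_modelsOnFibred`,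
`LefschetzSteinRealisationReduction.lean`; the same statement serves the summit-side assembly of that
fact as the helper `helper_wedge_pos_iff_of_exists` of
`Summits/SmoothPoincare4/…/ConvexBisectionAcyclicBisectionExistsContactSignPropagation.lean`, of which
the manifold part below is a port — Literature cannot import Summits).

**Statement** (`wedge₁₂_mextDeriv_pos_iff_of_exists`).  Let `N` be a connected `C^∞` manifold
modelled on `EuclideanSpace ℝ (Fin 3)` and `α, α'` two smooth `1`-forms
(`Literature.Geometry.Kaehler.MForm (𝓡 3) N ℝ 1`, `Literature.Geometry.Kaehler.IsSmoothForm`) whose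
`3`-forms `α ∧ dα`, `α' ∧ dα'` (`Literature.Geometry.Symplectic.wedge₁₂ (α y) (mextDeriv α y)`, read
at each point `y` in the preferred chart at `y`, as everywhere in Mathlib's tangent-bundle formalism)
vanish at no point and are both positive on one frame at one point.  Then at every point and on
every frame `α ∧ dα > 0 ↔ α' ∧ dα' > 0`.

**Proof.**
1. *Pointwise linear algebra* (`GirouxContactPathAlgebra.lean`): `(u, v, w) ↦ (a ∧ β)(u, v, w)` is
   the alternating `3`-form `wedgeForm a β`, hence `(a ∧ β)(u, v, w) = c · det[u, v, w]` with `c` its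
   value on the standard basis (`alt3_apply_eq_mul_det`; here `wedge₁₂_eq_frame_mul_det`), and
   pulling `a`, `β` back along an endomorphism `L` multiplies `a ∧ β` by `det L`
   (`wedge₁₂_compContinuousLinearMap_eq_det_mul`).
2. *Change of chart.* For `z` in the source of the chart `e = extChartAt (𝓡 3) y₀`, every form
   satisfies `γ z = (γ.inChart y₀ (e z)) ∘ T` with `T = tangentCoordChange (𝓡 3) z y₀ z`
   (`MForm.inChart_apply_self`, `MForm.inChart_extChartAt_eq_comp`); for smooth `γ` the
   representative of `dγ` in the chart at `y₀` is `extDeriv (γ.inChart y₀)` on the chart target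
   (`inChart_mextDeriv_of_mem_target`).  Hence
   `(α ∧ dα)(z)(e₀,e₁,e₂) · (α' ∧ dα')(z)(e₀,e₁,e₂) = (det T)² · G₀ (e z)` with `G₀` a continuous
   function on the chart target (`IsSmoothForm.contDiffOn_inChart`): the sign of the nowhere-zero
   product is locally constant (`eventually_pos_iff_wedge₁₂_mul`).
3. *Connectedness.* `{z | product > 0}` is clopen and non-empty, hence everything
   (`IsClopen.eq_univ`); with step 1 the two `3`-forms have the same sign on every frame.

## References
* H. Geiges, *An Introduction to Contact Topology*, CUP (2008), §1.1, Lemma 1.1.2 ff. (the sign of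
  `α ∧ dα` depends only on the co-oriented contact structure and the orientation). [folklore]
* F. W. Warner, *Foundations of Differentiable Manifolds and Lie Groups* (1983), 2.18–2.23 (chart
  representatives, naturality of `d`).
-/

noncomputable section

open scoped Manifold ContDiff Topology
open Set Function Filter Literature.Geometry.Kaehler

namespace Literature.Geometry.Symplectic

/-! ### Pointwise linear algebra of `wedge₁₂` (complements to `GirouxContactPathAlgebra.lean`) -/

section LinearAlgebra

variable (a : (EuclideanSpace ℝ (Fin 3)) [⋀^Fin 1]→L[ℝ] ℝ)
  (β : (EuclideanSpace ℝ (Fin 3)) [⋀^Fin 2]→L[ℝ] ℝ)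

/-- **`(a ∧ β)(u, v, w) = (a ∧ β)(e₀, e₁, e₂) · det[u, v, w]`** for the standard basis `e` of the
`3`-space: an alternating top form is a multiple of the determinant (`alt3_apply_eq_mul_det` for
the form `wedgeForm a β`). [folklore] -/
theorem wedge₁₂_eq_frame_mul_det (u v w : EuclideanSpace ℝ (Fin 3)) :
    wedge₁₂ a β u v w =
      wedge₁₂ a β (stdBasis3 0) (stdBasis3 1) (stdBasis3 2) * stdBasis3.det ![u, v, w] := by
  have h := alt3_apply_eq_mul_det (wedgeForm a β) ![u, v, w]
  rw [coe_stdBasis3_eq, wedgeForm_apply, wedgeForm_apply] at h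
  exact h

/-- **Pull-back multiplies `a ∧ β` by the determinant**:
`(L^*a ∧ L^*β)(u, v, w) = (a ∧ β)(Lu, Lv, Lw) = det L · (a ∧ β)(u, v, w)`. [folklore] -/
theorem wedge₁₂_compContinuousLinearMap_eq_det_mul
    (L : EuclideanSpace ℝ (Fin 3) →L[ℝ] EuclideanSpace ℝ (Fin 3)) (u v w : EuclideanSpace ℝ (Fin 3)) :
    wedge₁₂ (a.compContinuousLinearMap L) (β.compContinuousLinearMap L) u v w =
      LinearMap.det (L : EuclideanSpace ℝ (Fin 3) →ₗ[ℝ] EuclideanSpace ℝ (Fin 3)) *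
        wedge₁₂ a β u v w := by
  have h2 : (![L u, L v, L w] : Fin 3 → EuclideanSpace ℝ (Fin 3)) =
      (L : EuclideanSpace ℝ (Fin 3) →ₗ[ℝ] EuclideanSpace ℝ (Fin 3)) ∘ ![u, v, w] := by
    funext i
    fin_cases i <;> rfl
  rw [wedge₁₂_compContinuousLinearMap a β L u v w, wedge₁₂_eq_frame_mul_det a β (L u) (L v) (L w),
    wedge₁₂_eq_frame_mul_det a β u v w, h2, Module.Basis.det_comp]
  ring

/-- Two multiples `c D`, `c' D` of one quantity by factors with `c c' > 0` have the same sign.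
[folklore] -/
theorem pos_mul_iff_pos_mul_of_mul_pos {c c' D : ℝ} (h : 0 < c * c') :
    0 < c * D ↔ 0 < c' * D := by
  constructor <;> intro h' <;> nlinarith [mul_pos h h', sq_nonneg c, sq_nonneg c']

/-- If `c D > 0` and `c' D > 0` then `c c' > 0`. [folklore] -/
theorem mul_pos_of_pos_mul_of_pos_mul {c c' D : ℝ} (h : 0 < c * D) (h' : 0 < c' * D) :
    0 < c * c' := by
  nlinarith [mul_pos h h', sq_nonneg D, sq_nonneg (c * c')]

/-- If `g = d ^ 2 * G` and `g ≠ 0` then `g` and `G` have the same sign. [folklore] -/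
theorem pos_iff_pos_of_eq_sq_mul {g d G : ℝ} (h : g = d ^ 2 * G) (hg : g ≠ 0) : 0 < g ↔ 0 < G := by
  have hd : 0 < d ^ 2 := by
    rcases (sq_nonneg d).lt_or_eq with hd | hd
    · exact hd
    · exact absurd (by rw [h, ← hd, zero_mul]) hg
  rw [h]
  exact mul_pos_iff_of_pos_left hd

end LinearAlgebra

/-! ### Change of chart for `α` and `dα`, local constancy of the sign -/

section Manifold

variable {N : Type*} [TopologicalSpace N] [ChartedSpace (EuclideanSpace ℝ (Fin 3)) N]
  [IsManifold (𝓡 3) ∞ N]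

/-- **A form read in another chart.** For `y` in the source of the chart at `y₀`, the value
`γ y` (the form in the preferred chart at `y`) is the representative of `γ` in the chart at
`y₀` at the point `extChartAt (𝓡 3) y₀ y`, pulled back along the tangent coordinate change from
the chart at `y` to the chart at `y₀` (`MForm.inChart_apply_self` and
`MForm.inChart_extChartAt_eq_comp`; Warner (1983), 2.18). [folklore] -/
theorem mform_apply_eq_inChart_comp {k : ℕ} (γ : MForm (𝓡 3) N ℝ k) {y₀ y : N}
    (hy : y ∈ (extChartAt (𝓡 3) y₀).source) :
    γ y = (γ.inChart y₀ (extChartAt (𝓡 3) y₀ y)).compContinuousLinearMap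
      (tangentCoordChange (𝓡 3) y y₀ y) := by
  rw [← γ.inChart_apply_self y]
  exact γ.inChart_extChartAt_eq_comp (mem_extChartAt_source y) hy

/-- **`dγ` read in the chart at `y₀` is `d` of the representative** on the whole chart target,
for a smooth form (`inChart_mextDeriv_of_mem_target`, boundaryless model `𝓡 3`; Warner (1983),
Prop. 2.23). [folklore] -/
theorem inChart_mextDeriv_eq_extDeriv_inChart {γ : MForm (𝓡 3) N ℝ 1} (hγ : IsSmoothForm γ) {y₀ : N}
    {q : EuclideanSpace ℝ (Fin 3)} (hq : q ∈ (extChartAt (𝓡 3) y₀).target) :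
    (mextDeriv γ).inChart y₀ q = extDeriv (γ.inChart y₀) q := by
  rw [inChart_mextDeriv_of_mem_target γ hq (hγ _), ModelWithCorners.range_eq_univ,
    extDerivWithin_univ]

/-- **Chart-change formula for `γ ∧ dγ`.** For a smooth `1`-form `γ` and `z` in the source of
the chart at `y₀`: `(γ ∧ dγ)(z)(u, v, w) = det T · (A ∧ dA)(extChartAt (𝓡 3) y₀ z)(u, v, w)`,
where `A = γ.inChart y₀` is the representative in the FIXED chart at `y₀`, `dA = extDeriv A`, and
`T = tangentCoordChange (𝓡 3) z y₀ z` is the derivative of the transition map from the chart at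
`z` to the chart at `y₀`. [folklore] -/
theorem wedge₁₂_mextDeriv_eq_det_mul {γ : MForm (𝓡 3) N ℝ 1} (hγ : IsSmoothForm γ) {y₀ z : N}
    (hz : z ∈ (extChartAt (𝓡 3) y₀).source) (u v w : EuclideanSpace ℝ (Fin 3)) :
    wedge₁₂ (γ z) (mextDeriv γ z) u v w =
      LinearMap.det (tangentCoordChange (𝓡 3) z y₀ z :
          EuclideanSpace ℝ (Fin 3) →ₗ[ℝ] EuclideanSpace ℝ (Fin 3)) *
        wedge₁₂ (γ.inChart y₀ (extChartAt (𝓡 3) y₀ z))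
          (extDeriv (γ.inChart y₀) (extChartAt (𝓡 3) y₀ z)) u v w := by
  rw [← inChart_mextDeriv_eq_extDeriv_inChart hγ ((extChartAt (𝓡 3) y₀).map_source hz),
    mform_apply_eq_inChart_comp γ hz, mform_apply_eq_inChart_comp (mextDeriv γ) hz,
    wedge₁₂_compContinuousLinearMap_eq_det_mul]

/-- For a smooth `1`-form `γ`, the function `q ↦ (A ∧ dA)(q)(e₀, e₁, e₂)` of the representative
`A = γ.inChart y₀` is continuous on the target of the chart at `y₀` (the representative is `C^∞`
there, `IsSmoothForm.contDiffOn_inChart`). [folklore] -/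
theorem continuousOn_wedge₁₂_inChart {γ : MForm (𝓡 3) N ℝ 1} (hγ : IsSmoothForm γ) (y₀ : N)
    (e₀ e₁ e₂ : EuclideanSpace ℝ (Fin 3)) :
    ContinuousOn (fun q ↦ wedge₁₂ (γ.inChart y₀ q) (extDeriv (γ.inChart y₀) q) e₀ e₁ e₂)
      (extChartAt (𝓡 3) y₀).target := by
  have hA : ContDiffOn ℝ ∞ (γ.inChart y₀) (extChartAt (𝓡 3) y₀).target := hγ.contDiffOn_inChart y₀
  have hAc : ContinuousOn (γ.inChart y₀) (extChartAt (𝓡 3) y₀).target := hA.continuousOn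
  have hdA : ContinuousOn (extDeriv (γ.inChart y₀)) (extChartAt (𝓡 3) y₀).target := by
    have h := hA.continuousOn_fderiv_of_isOpen (isOpen_extChartAt_target y₀) (by simp)
    exact (ContinuousAlternatingMap.alternatizeUncurryFinCLM ℝ (EuclideanSpace ℝ (Fin 3))
      ℝ).continuous.comp_continuousOn h
  simp only [wedge₁₂]
  exact ((hAc.eval_const _).mul (hdA.eval_const _)).sub ((hAc.eval_const _).mul
    (hdA.eval_const _)) |>.add ((hAc.eval_const _).mul (hdA.eval_const _))

/-- **Local constancy of the sign of `(α ∧ dα)(e) · (α' ∧ dα')(e)`.** If this product (read at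
each point in the preferred chart there, on a fixed triple `e = (e₀, e₁, e₂)`) vanishes nowhere,
then near every point `y₀` it has the sign it has at `y₀`: by the chart-change formula it is
`(det T)²` times the continuous nowhere-zero function `G₀ ∘ extChartAt (𝓡 3) y₀`,
`G₀ (q) = (A ∧ dA)(q)(e) · (A' ∧ dA')(q)(e)`, of the representatives in the fixed chart at `y₀`.
[folklore] -/
theorem eventually_pos_iff_wedge₁₂_mul {α α' : MForm (𝓡 3) N ℝ 1} (hα : IsSmoothForm α)
    (hα' : IsSmoothForm α') (e₀ e₁ e₂ : EuclideanSpace ℝ (Fin 3))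
    (h0 : ∀ z, wedge₁₂ (α z) (mextDeriv α z) e₀ e₁ e₂ *
      wedge₁₂ (α' z) (mextDeriv α' z) e₀ e₁ e₂ ≠ 0) (y₀ : N) :
    ∀ᶠ z in 𝓝 y₀,
      (0 < wedge₁₂ (α z) (mextDeriv α z) e₀ e₁ e₂ * wedge₁₂ (α' z) (mextDeriv α' z) e₀ e₁ e₂ ↔
        0 < wedge₁₂ (α y₀) (mextDeriv α y₀) e₀ e₁ e₂ *
          wedge₁₂ (α' y₀) (mextDeriv α' y₀) e₀ e₁ e₂) := by
  -- the comparison function in the fixed chart at `y₀`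
  set G₀ : EuclideanSpace ℝ (Fin 3) → ℝ := fun q ↦
    wedge₁₂ (α.inChart y₀ q) (extDeriv (α.inChart y₀) q) e₀ e₁ e₂ *
      wedge₁₂ (α'.inChart y₀ q) (extDeriv (α'.inChart y₀) q) e₀ e₁ e₂ with hG₀
  have hG₀c : ContinuousOn G₀ (extChartAt (𝓡 3) y₀).target :=
    (continuousOn_wedge₁₂_inChart hα y₀ e₀ e₁ e₂).mul (continuousOn_wedge₁₂_inChart hα' y₀ e₀ e₁ e₂)
  -- the chart-change formula on the source of the chart at `y₀`
  have hformula : ∀ z ∈ (extChartAt (𝓡 3) y₀).source,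
      wedge₁₂ (α z) (mextDeriv α z) e₀ e₁ e₂ * wedge₁₂ (α' z) (mextDeriv α' z) e₀ e₁ e₂ =
        LinearMap.det (tangentCoordChange (𝓡 3) z y₀ z :
          EuclideanSpace ℝ (Fin 3) →ₗ[ℝ] EuclideanSpace ℝ (Fin 3)) ^ 2 *
          G₀ (extChartAt (𝓡 3) y₀ z) := by
    intro z hz
    rw [hG₀, wedge₁₂_mextDeriv_eq_det_mul hα hz, wedge₁₂_mextDeriv_eq_det_mul hα' hz]
    ring
  have hsign : ∀ z ∈ (extChartAt (𝓡 3) y₀).source,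
      (0 < wedge₁₂ (α z) (mextDeriv α z) e₀ e₁ e₂ * wedge₁₂ (α' z) (mextDeriv α' z) e₀ e₁ e₂ ↔
        0 < G₀ (extChartAt (𝓡 3) y₀ z)) := fun z hz ↦
    pos_iff_pos_of_eq_sq_mul (hformula z hz) (h0 z)
  have hG₀ne : ∀ z ∈ (extChartAt (𝓡 3) y₀).source, G₀ (extChartAt (𝓡 3) y₀ z) ≠ 0 := by
    intro z hz h
    apply h0 z
    rw [hformula z hz, h, mul_zero]
  -- continuity of `G₀ ∘ extChartAt y₀` at `y₀`
  have hc : ContinuousAt (fun z ↦ G₀ (extChartAt (𝓡 3) y₀ z)) y₀ := by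
    have h1 : ContinuousWithinAt (fun z ↦ G₀ (extChartAt (𝓡 3) y₀ z))
        (extChartAt (𝓡 3) y₀).source y₀ :=
      (hG₀c _ (mem_extChartAt_target y₀)).comp (continuousAt_extChartAt y₀).continuousWithinAt
        fun z hz ↦ (extChartAt (𝓡 3) y₀).map_source hz
    exact h1.continuousAt (extChartAt_source_mem_nhds y₀)
  have hy₀ : y₀ ∈ (extChartAt (𝓡 3) y₀).source := mem_extChartAt_source y₀
  have hev : ∀ᶠ z in 𝓝 y₀, z ∈ (extChartAt (𝓡 3) y₀).source := extChartAt_source_mem_nhds y₀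
  rcases lt_or_gt_of_ne (hG₀ne y₀ hy₀) with hneg | hpos
  · have hev' : ∀ᶠ z in 𝓝 y₀, G₀ (extChartAt (𝓡 3) y₀ z) < 0 :=
      hc.tendsto.eventually (gt_mem_nhds hneg)
    filter_upwards [hev, hev'] with z hz hz'
    rw [hsign z hz, hsign y₀ hy₀]
    exact iff_of_false (not_lt.2 hz'.le) (not_lt.2 hneg.le)
  · have hev' : ∀ᶠ z in 𝓝 y₀, 0 < G₀ (extChartAt (𝓡 3) y₀ z) :=
      hc.tendsto.eventually (lt_mem_nhds hpos)
    filter_upwards [hev, hev'] with z hz hz'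
    rw [hsign z hz, hsign y₀ hy₀]
    exact iff_of_true hz' hpos

/-! ### Sign propagation on a connected `3`-manifold -/

/-- **Two contact-type forms on a connected `3`-manifold which define the same orientation at
one point define the same orientation everywhere.**  For smooth `1`-forms `α, α'` on a connected
`C^∞` `3`-manifold `N` whose `3`-forms `α ∧ dα`, `α' ∧ dα'` (`wedge₁₂ (α y) (mextDeriv α y)`,
read at `y` in the preferred chart at `y`) vanish at no point and are positive on a common frame
at a common point, `(α ∧ dα)(y)(u, v, w) > 0 ↔ (α' ∧ dα')(y)(u, v, w) > 0` for all `y, u, v, w`.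
Proof: `(α ∧ dα)(y) = c(y) det`, `(α' ∧ dα')(y) = c'(y) det` pointwise
(`wedge₁₂_eq_frame_mul_det`); the sign of the nowhere-zero `c c'` is locally constant
(`eventually_pos_iff_wedge₁₂_mul`: under a change of chart both factors acquire the same Jacobian
determinant), hence constant on the connected `N` (`IsClopen.eq_univ`) and positive at the given
point.  (The sign of `α ∧ dα` is a property of the co-oriented contact structure and of the
orientation only: Geiges 2008, §1.1.) [folklore] -/
theorem wedge₁₂_mextDeriv_pos_iff_of_exists [ConnectedSpace N] {α α' : MForm (𝓡 3) N ℝ 1}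
    (hα : IsSmoothForm α) (hα' : IsSmoothForm α')
    (hne : ∀ y, ∃ u v w : EuclideanSpace ℝ (Fin 3), wedge₁₂ (α y) (mextDeriv α y) u v w ≠ 0)
    (hne' : ∀ y, ∃ u v w : EuclideanSpace ℝ (Fin 3), wedge₁₂ (α' y) (mextDeriv α' y) u v w ≠ 0)
    (hpos : ∃ (y : N) (u v w : EuclideanSpace ℝ (Fin 3)),
      0 < wedge₁₂ (α y) (mextDeriv α y) u v w ∧ 0 < wedge₁₂ (α' y) (mextDeriv α' y) u v w)
    (y : N) (u v w : EuclideanSpace ℝ (Fin 3)) :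
    0 < wedge₁₂ (α y) (mextDeriv α y) u v w ↔ 0 < wedge₁₂ (α' y) (mextDeriv α' y) u v w := by
  -- frame coefficients on the standard frame `e`
  have key : ∀ (z : N) (u v w : EuclideanSpace ℝ (Fin 3)),
      wedge₁₂ (α z) (mextDeriv α z) u v w =
        wedge₁₂ (α z) (mextDeriv α z) (stdBasis3 0) (stdBasis3 1) (stdBasis3 2) *
          stdBasis3.det ![u, v, w] := fun z u v w ↦
    wedge₁₂_eq_frame_mul_det _ _ u v w
  have key' : ∀ (z : N) (u v w : EuclideanSpace ℝ (Fin 3)),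
      wedge₁₂ (α' z) (mextDeriv α' z) u v w =
        wedge₁₂ (α' z) (mextDeriv α' z) (stdBasis3 0) (stdBasis3 1) (stdBasis3 2) *
          stdBasis3.det ![u, v, w] := fun z u v w ↦
    wedge₁₂_eq_frame_mul_det _ _ u v w
  -- the product of the frame coefficients vanishes nowhere …
  have h0 : ∀ z, wedge₁₂ (α z) (mextDeriv α z) (stdBasis3 0) (stdBasis3 1) (stdBasis3 2) *
      wedge₁₂ (α' z) (mextDeriv α' z) (stdBasis3 0) (stdBasis3 1) (stdBasis3 2) ≠ 0 := by
    intro z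
    obtain ⟨u₁, v₁, w₁, h₁⟩ := hne z
    obtain ⟨u₂, v₂, w₂, h₂⟩ := hne' z
    rw [key] at h₁
    rw [key'] at h₂
    exact mul_ne_zero (left_ne_zero_of_mul h₁) (left_ne_zero_of_mul h₂)
  -- … so the set where it is positive is clopen, and it is nonempty
  set S : Set N := {z | 0 < wedge₁₂ (α z) (mextDeriv α z) (stdBasis3 0) (stdBasis3 1) (stdBasis3 2) *
    wedge₁₂ (α' z) (mextDeriv α' z) (stdBasis3 0) (stdBasis3 1) (stdBasis3 2)} with hS
  have hSo : IsOpen S := by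
    refine isOpen_iff_mem_nhds.2 fun z hz ↦ ?_
    exact (eventually_pos_iff_wedge₁₂_mul hα hα' (stdBasis3 0) (stdBasis3 1) (stdBasis3 2) h0
      z).mono fun x hx ↦ hx.2 hz
  have hSc : IsClosed S := by
    rw [← isOpen_compl_iff]
    refine isOpen_iff_mem_nhds.2 fun z hz ↦ ?_
    exact (eventually_pos_iff_wedge₁₂_mul hα hα' (stdBasis3 0) (stdBasis3 1) (stdBasis3 2) h0
      z).mono fun x hx h ↦ hz (hx.1 h)
  have hSne : S.Nonempty := by
    obtain ⟨y₁, u₁, v₁, w₁, h₁, h₂⟩ := hpos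
    rw [key] at h₁
    rw [key'] at h₂
    exact ⟨y₁, mul_pos_of_pos_mul_of_pos_mul h₁ h₂⟩
  have hall : S = univ := IsClopen.eq_univ ⟨hSc, hSo⟩ hSne
  have hy : y ∈ S := by
    rw [hall]
    exact mem_univ y
  rw [key, key']
  exact pos_mul_iff_pos_mul_of_mul_pos hy

end Manifold

end Literature.Geometry.Symplectic

end
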